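import Literature.Computability.MetaComplexity.TwoModuliExpSums
import Literature.Analysis.Fourier.DiscreteSummationByParts

set_option linter.dupNamespace false
set_option linter.unusedSectionVars false

/-!
# PairLawA (lens 4, g29; kernel step K3a of the (c0) road = (P7)(ii) of REFEREE-66v65) — THE cos² LAW FOR DIFFERENCES OF CUBE POINTS

Blocker `X = AbsorptionDial.NoPerfectPolyOdd` (item 28487); decomp-qadv lens 4, g29.  The random vector of the NON-dispersing branch is
`d = x − x′ ∈ {0,±1}^ι` with `x, x′` independent uniform points of `{0,1}^ι` — EXACTLY the pairs `(x₁, x₁′)` counted in hypothesis (d2′) of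
`BilinearCubeSumA` / `ColumnBridgeA`.  For coordinate vectors `c_i ∈ 𝔽_p^K` put `A d := Σ_i d_i c_i`.  Fourier inversion on `𝔽_p^K` and the
factorisation of the cube sum give the COUNTING FORMULA

  `#{(x,x′) : A(x−x′) = v} · p^K = Σ_ξ χ_p(−⟨ξ,v⟩) · ∏_i ‖1 + χ_p(⟨ξ,c_i⟩)‖²`      (`card_pairs_mul_eq`)

with NON-NEGATIVE Fourier coefficients `∏_i ‖1+χ_p(⟨ξ,c_i⟩)‖² = 4^{|ι|} ∏_i cos²(π⟨ξ,c_i⟩/p)` — this is (P7)(ii) «E_{d_j} e_p(d_jγ) = cos²(πγ/p) ≥ 0»;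
hence every fibre is at most the zero fibre's Fourier majorant and

  `#{(x,x′) : A(x−x′) = v} · p^K ≤ 4^{|ι|} · Σ_ξ (cos²(π/p))^{n(ξ)}`,  `n(ξ) = #{i : ⟨ξ,c_i⟩ ≠ 0}`      (`card_pairs_le_cos`)

(the tree's `norm_one_add_stdAddChar_le`: `‖1 + χ_p(γ)‖ ≤ 2cos(π/p)` for `γ ≠ 0`).  This is the input of (P7)(iii)–(v) (spectral level set `Ξ_h`,
Bogolyubov–Ruzsa [Sanders, arXiv:1011.0107 Thm 20], rank bound), which stay for later: with them, «no bipartition disperses» forces every cross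
block of `M+Mᵀ` on the pool to have polylog rank, i.e. the (P8) kernel `offDiag_lowRank` applies.
-/

open Finset Complex ZMod
open scoped ComplexConjugate
open Literature.Computability.MetaComplexity.TwoModuli

namespace Summit.QuantumAdvantage.QuantumAdvantage.Theorems.PairLaw

variable {p : ℕ} [NeZero p] {ι : Type*} [Fintype ι] [DecidableEq ι] {K : ℕ}

/-- the `0/1` value of a Boolean coordinate in `𝔽_p` -/
def bit (b : Bool) : ZMod p := if b then 1 else 0

/-- the difference map `(x, x′) ↦ A(x − x′) = Σ_i ([x i] − [x′ i]) c_i ∈ 𝔽_p^K` -/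
def diffMap (c : ι → Fin K → ZMod p) (xx : (ι → Bool) × (ι → Bool)) : Fin K → ZMod p :=
  fun j => ∑ i, (bit (xx.1 i) - bit (xx.2 i)) * c i j

/-- the number of ordered pairs of cube points in the fibre of `v` -/
noncomputable def pairCount (c : ι → Fin K → ZMod p) (v : Fin K → ZMod p) : ℕ :=
  (univ.filter fun xx : (ι → Bool) × (ι → Bool) => diffMap c xx = v).card

/-- **the cube sum of a form, as a product**: `Σ_x χ_p(Σ_{x i} β_i) = ∏_i (1 + χ_p(β_i))` -/
theorem cubeSum_eq_prod (β : ι → ZMod p) :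
    ∑ x : ι → Bool, (stdAddChar (∑ i, if x i then β i else 0) : ℂ) = ∏ i, ((1 : ℂ) + stdAddChar (β i)) := by
  have hterm : ∀ x : ι → Bool, (stdAddChar (∑ i, if x i then β i else 0) : ℂ)
      = ∏ i, (fun (i : ι) (b : Bool) => if b then (stdAddChar (β i) : ℂ) else 1) i (x i) := by
    intro x
    rw [stdAddChar_sum_ite]
  simp_rw [hterm]
  rw [sum_bool_fun_prod (fun (i : ι) (b : Bool) => if b then (stdAddChar (β i) : ℂ) else 1)]
  refine prod_congr rfl fun i _ => ?_
  simp

omit [NeZero p] [DecidableEq ι] in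
/-- the dual pairing with the difference map splits into the two cube phases of the combined form `β(ξ)_i = ⟨ξ, c_i⟩` -/
theorem sum_mul_diffMap (c : ι → Fin K → ZMod p) (ξ : Fin K → ZMod p) (xx : (ι → Bool) × (ι → Bool)) :
    ∑ j, ξ j * diffMap c xx j
      = (∑ i, if xx.1 i then (∑ j, ξ j * c i j) else 0) - ∑ i, if xx.2 i then (∑ j, ξ j * c i j) else 0 := by
  unfold diffMap bit
  rw [← sum_sub_distrib]
  simp_rw [mul_sum]
  rw [sum_comm]
  refine sum_congr rfl fun i _ => ?_
  cases xx.1 i <;> cases xx.2 i <;> simp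

/-- **THE COUNTING FORMULA.**  `#{(x,x′) : A(x−x′) = v} · p^K = Σ_ξ χ_p(−⟨ξ,v⟩) ∏_i ‖1 + χ_p(⟨ξ,c_i⟩)‖²` — all Fourier coefficients of the law of
`A(x − x′)` are non-negative reals. -/
theorem card_pairs_mul_eq (c : ι → Fin K → ZMod p) (v : Fin K → ZMod p) :
    (pairCount c v : ℂ) * (p : ℂ) ^ K
      = ∑ ξ : Fin K → ZMod p, (stdAddChar (-∑ j, ξ j * v j) : ℂ) * (((∏ i, ‖(1 : ℂ) + stdAddChar (∑ j, ξ j * c i j)‖ ^ 2 : ℝ)) : ℂ) := by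
  classical
  have hpK : ((p : ℂ) ^ K) ≠ 0 := pow_ne_zero _ (by exact_mod_cast NeZero.ne p)
  unfold pairCount
  rw [natCast_card_filter, sum_mul]
  -- expand each indicator
  have hind : ∀ xx : (ι → Bool) × (ι → Bool), (if diffMap c xx = v then (1 : ℂ) else 0) * (p : ℂ) ^ K
      = ∑ ξ : Fin K → ZMod p, (stdAddChar (-∑ j, ξ j * v j) : ℂ) *
          ((stdAddChar (∑ i, if xx.1 i then (∑ j, ξ j * c i j) else 0) : ℂ) *
            conj (stdAddChar (∑ i, if xx.2 i then (∑ j, ξ j * c i j) else 0) : ℂ)) := by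
    intro xx
    rw [ite_eq_eq_sum_stdAddChar (diffMap c xx) v, mul_comm, ← mul_assoc, mul_inv_cancel₀ hpK, one_mul]
    refine sum_congr rfl fun ξ _ => ?_
    have hsplit : ∑ j, ξ j * (diffMap c xx j - v j) = (∑ j, ξ j * diffMap c xx j) + (-∑ j, ξ j * v j) := by
      rw [← sub_eq_add_neg, ← sum_sub_distrib]
      refine sum_congr rfl fun j _ => ?_
      ring
    rw [hsplit, AddChar.map_add_eq_mul, sum_mul_diffMap, sub_eq_add_neg, AddChar.map_add_eq_mul,
      Literature.Analysis.Fourier.conj_stdAddChar]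
    ring
  simp_rw [hind]
  rw [sum_comm]
  refine sum_congr rfl fun ξ _ => ?_
  rw [← mul_sum]
  congr 1
  -- the double sum factorises as `S · conj S = ‖S‖²`, `S` the cube sum of `β(ξ)`
  rw [Fintype.sum_prod_type]
  dsimp only
  have hfac : ∑ x : ι → Bool, ∑ y : ι → Bool, (stdAddChar (∑ i, if x i then (∑ j, ξ j * c i j) else 0) : ℂ)
        * conj (stdAddChar (∑ i, if y i then (∑ j, ξ j * c i j) else 0) : ℂ)
      = (∑ x : ι → Bool, (stdAddChar (∑ i, if x i then (∑ j, ξ j * c i j) else 0) : ℂ))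
        * conj (∑ x : ι → Bool, (stdAddChar (∑ i, if x i then (∑ j, ξ j * c i j) else 0) : ℂ)) := by
    rw [map_sum, sum_mul]
    exact sum_congr rfl fun x _ => by rw [mul_sum]
  rw [hfac, cubeSum_eq_prod, Complex.mul_conj, Complex.normSq_eq_norm_sq, Complex.norm_prod, ← prod_pow]

/-- the Fourier majorant: every fibre is bounded by the (real, non-negative) sum of the coefficients -/
theorem card_pairs_le (c : ι → Fin K → ZMod p) (v : Fin K → ZMod p) :
    (pairCount c v : ℝ) * (p : ℝ) ^ K ≤ ∑ ξ : Fin K → ZMod p, ∏ i, ‖(1 : ℂ) + stdAddChar (∑ j, ξ j * c i j)‖ ^ 2 := by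
  have h := card_pairs_mul_eq c v
  have hreal : (pairCount c v : ℝ) * (p : ℝ) ^ K = ‖(pairCount c v : ℂ) * (p : ℂ) ^ K‖ := by
    rw [norm_mul, norm_pow, Complex.norm_natCast, Complex.norm_natCast]
  rw [hreal, h]
  refine (norm_sum_le _ _).trans (sum_le_sum fun ξ _ => ?_)
  rw [norm_mul, Literature.Analysis.Fourier.norm_stdAddChar, one_mul, Complex.norm_real, Real.norm_eq_abs,
    abs_of_nonneg (prod_nonneg fun i _ => sq_nonneg _)]

omit [DecidableEq ι] in
/-- the coefficient at `ξ` is at most `4^{|ι|} (cos²(π/p))^{n(ξ)}`, `n(ξ) = #{i : ⟨ξ,c_i⟩ ≠ 0}` (`‖1 + χ_p(γ)‖ ≤ 2cos(π/p)` for `γ ≠ 0`, `≤ 2` always) -/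
theorem prod_norm_sq_le (hp2 : 2 ≤ p) (β : ι → ZMod p) :
    ∏ i, ‖(1 : ℂ) + stdAddChar (β i)‖ ^ 2 ≤ 4 ^ Fintype.card ι * (Real.cos (Real.pi / p) ^ 2) ^ (univ.filter fun i => β i ≠ 0).card := by
  have hp2' : (2 : ℝ) ≤ p := by exact_mod_cast hp2
  have hcos0 : 0 ≤ Real.cos (Real.pi / p) := by
    apply Real.cos_nonneg_of_neg_pi_div_two_le_of_le
    · have : 0 ≤ Real.pi / p := by positivity
      linarith [Real.pi_pos]
    · exact div_le_div_of_nonneg_left Real.pi_pos.le (by norm_num) hp2'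
  have hfac : ∀ i, ‖(1 : ℂ) + stdAddChar (β i)‖ ^ 2 ≤ 4 * (if β i ≠ 0 then Real.cos (Real.pi / p) ^ 2 else 1) := by
    intro i
    split_ifs with hi
    · have h := norm_one_add_stdAddChar_le hi
      calc ‖(1 : ℂ) + stdAddChar (β i)‖ ^ 2 ≤ (2 * Real.cos (Real.pi / p)) ^ 2 := pow_le_pow_left₀ (norm_nonneg _) h 2
        _ = 4 * Real.cos (Real.pi / p) ^ 2 := by ring
    · calc ‖(1 : ℂ) + stdAddChar (β i)‖ ^ 2 ≤ (‖(1 : ℂ)‖ + ‖(stdAddChar (β i) : ℂ)‖) ^ 2 :=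
            pow_le_pow_left₀ (norm_nonneg _) (norm_add_le _ _) 2
        _ = 4 * 1 := by rw [norm_one, Literature.Analysis.Fourier.norm_stdAddChar]; norm_num
  calc ∏ i, ‖(1 : ℂ) + stdAddChar (β i)‖ ^ 2 ≤ ∏ i, 4 * (if β i ≠ 0 then Real.cos (Real.pi / p) ^ 2 else (1 : ℝ)) :=
        prod_le_prod (fun i _ => sq_nonneg _) fun i _ => hfac i
    _ = 4 ^ Fintype.card ι * (Real.cos (Real.pi / p) ^ 2) ^ (univ.filter fun i => β i ≠ 0).card := by
        rw [prod_mul_distrib, prod_const, card_univ, prod_ite, prod_const_one, mul_one, prod_const]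

/-- **THE cos² LAW ((P7)(ii)).**  For every target `v`,
`#{(x,x′) ∈ {0,1}^ι × {0,1}^ι : Σ_i([x i]−[x′ i]) c_i = v} · p^K ≤ 4^{|ι|} · Σ_ξ (cos²(π/p))^{#{i : ⟨ξ,c_i⟩ ≠ 0}}`. -/
theorem card_pairs_le_cos (hp2 : 2 ≤ p) (c : ι → Fin K → ZMod p) (v : Fin K → ZMod p) :
    (pairCount c v : ℝ) * (p : ℝ) ^ K
      ≤ 4 ^ Fintype.card ι * ∑ ξ : Fin K → ZMod p,
          (Real.cos (Real.pi / p) ^ 2) ^ (univ.filter fun i => (∑ j, ξ j * c i j) ≠ 0).card := by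
  refine (card_pairs_le c v).trans ?_
  rw [mul_sum]
  exact sum_le_sum fun ξ _ => prod_norm_sq_le hp2 _

section LevelSet

variable (c : ι → Fin K → ZMod p)

/-- `n(ξ) = #{i : ⟨ξ, c_i⟩ ≠ 0}`: the number of forms the dual vector `ξ` sees -/
noncomputable def nDual (ξ : Fin K → ZMod p) : ℕ := (univ.filter fun i => (∑ j, ξ j * c i j) ≠ 0).card

/-- the spectral level set `Ξ_h = {ξ : n(ξ) ≤ h}` of (P7)(iii) -/
noncomputable def levelSet (h : ℕ) : Finset (Fin K → ZMod p) := univ.filter fun ξ => nDual c ξ ≤ h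

/-- the sparse targets `{v : wt v < w₂}` -/
noncomputable def sparseSet (K w₂ : ℕ) : Finset (Fin K → ZMod p) :=
  univ.filter fun v => (univ.filter fun j => v j ≠ 0).card < w₂

/-- `n(0) = 0` -/
theorem nDual_zero : nDual c 0 = 0 := by
  simp [nDual]

/-- `n(−ξ) = n(ξ)` -/
theorem nDual_neg (ξ : Fin K → ZMod p) : nDual c (-ξ) = nDual c ξ := by
  unfold nDual
  congr 1
  ext i
  simp only [mem_filter, mem_univ, true_and, Pi.neg_apply, neg_mul, sum_neg_distrib, neg_ne_zero]

/-- subadditivity `n(ξ + ξ′) ≤ n(ξ) + n(ξ′)` ((P7)(iv)) -/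
theorem nDual_add_le (ξ ξ' : Fin K → ZMod p) : nDual c (ξ + ξ') ≤ nDual c ξ + nDual c ξ' := by
  unfold nDual
  rw [← card_union_add_card_inter]
  refine le_trans (card_le_card ?_) (Nat.le_add_right _ _)
  intro i hi
  simp only [mem_union, mem_filter, mem_univ, true_and] at hi ⊢
  by_contra hcon
  push Not at hcon
  apply hi
  calc ∑ j, (ξ + ξ') j * c i j = (∑ j, ξ j * c i j) + ∑ j, ξ' j * c i j := by
        simp only [Pi.add_apply, add_mul, sum_add_distrib]
    _ = 0 := by rw [hcon.1, hcon.2, add_zero]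

/-- `0 ∈ Ξ_h` -/
theorem zero_mem_levelSet (h : ℕ) : (0 : Fin K → ZMod p) ∈ levelSet c h := by
  simp [levelSet, nDual_zero]

/-- `Ξ_h = −Ξ_h` -/
theorem neg_mem_levelSet {h : ℕ} {ξ : Fin K → ZMod p} (hξ : ξ ∈ levelSet c h) : -ξ ∈ levelSet c h := by
  simp only [levelSet, mem_filter, mem_univ, true_and] at hξ ⊢
  rwa [nDual_neg]

/-- `Ξ_a + Ξ_b ⊆ Ξ_{a+b}` ((P7)(iv): the input shape of the Bogolyubov–Ruzsa step) -/
theorem add_mem_levelSet {a b : ℕ} {ξ ξ' : Fin K → ZMod p} (hξ : ξ ∈ levelSet c a) (hξ' : ξ' ∈ levelSet c b) :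
    ξ + ξ' ∈ levelSet c (a + b) := by
  simp only [levelSet, mem_filter, mem_univ, true_and] at hξ hξ' ⊢
  exact (nDual_add_le c ξ ξ').trans (add_le_add hξ hξ')

/-- spectral sum versus level set ((P7)(iii)): `Σ_ξ θ^{n(ξ)} ≤ |Ξ_h| + p^K θ^{h+1}` for `0 ≤ θ ≤ 1` -/
theorem spectral_sum_le (θ : ℝ) (h0 : 0 ≤ θ) (h1 : θ ≤ 1) (h : ℕ) :
    ∑ ξ : Fin K → ZMod p, θ ^ nDual c ξ ≤ (levelSet c h).card + (p : ℝ) ^ K * θ ^ (h + 1) := by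
  classical
  rw [← sum_filter_add_sum_filter_not univ (fun ξ => nDual c ξ ≤ h) (fun ξ => θ ^ nDual c ξ)]
  apply add_le_add
  · calc ∑ ξ ∈ univ.filter (fun ξ => nDual c ξ ≤ h), θ ^ nDual c ξ
          ≤ ∑ ξ ∈ univ.filter (fun ξ => nDual c ξ ≤ h), (1 : ℝ) := sum_le_sum fun ξ _ => pow_le_one₀ h0 h1
      _ = (levelSet c h).card := by rw [sum_const, nsmul_eq_mul, mul_one]; rfl
  · calc ∑ ξ ∈ univ.filter (fun ξ => ¬ nDual c ξ ≤ h), θ ^ nDual c ξ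
          ≤ ∑ ξ ∈ univ.filter (fun ξ => ¬ nDual c ξ ≤ h), θ ^ (h + 1) :=
            sum_le_sum fun ξ hξ => pow_le_pow_of_le_one h0 h1 (by rw [mem_filter] at hξ; omega)
      _ ≤ ∑ ξ : Fin K → ZMod p, θ ^ (h + 1) :=
            sum_le_sum_of_subset_of_nonneg (filter_subset _ _) fun _ _ _ => pow_nonneg h0 _
      _ = (p : ℝ) ^ K * θ ^ (h + 1) := by
            rw [sum_const, card_univ, Fintype.card_fun, Fintype.card_fin, ZMod.card, nsmul_eq_mul]
            push_cast
            ring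

/-- the low-weight pairs, counted fibrewise over the sparse targets -/
theorem card_lowPairs_eq (w₂ : ℕ) :
    (univ.filter fun xx : (ι → Bool) × (ι → Bool) => (univ.filter fun j => diffMap c xx j ≠ 0).card < w₂).card
      = ∑ v ∈ sparseSet (p := p) K w₂, pairCount c v := by
  classical
  unfold pairCount sparseSet
  rw [card_eq_sum_card_fiberwise (f := diffMap c)
    (t := univ.filter fun v : Fin K → ZMod p => (univ.filter fun j => v j ≠ 0).card < w₂)]
  · refine sum_congr rfl fun v hv => ?_
    rw [mem_filter] at hv
    congr 1
    ext xx
    simp only [mem_filter, mem_univ, true_and]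
    exact ⟨fun hx => hx.2, fun hx => ⟨by rw [hx]; exact hv.2, hx⟩⟩
  · intro xx hxx
    simp only [coe_filter, Set.mem_setOf_eq, mem_univ, true_and] at hxx ⊢
    exact hxx

/-- pigeonhole ((P7)(i)): more than `E` low-weight pairs ⟹ a POPULAR sparse target `v`, `pairCount v · #sparse > E` -/
theorem exists_popular_sparse (w₂ E : ℕ)
    (hfail : E < (univ.filter fun xx : (ι → Bool) × (ι → Bool) =>
      (univ.filter fun j => diffMap c xx j ≠ 0).card < w₂).card) :
    ∃ v ∈ sparseSet (p := p) K w₂, E < pairCount c v * (sparseSet (p := p) K w₂).card := by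
  classical
  rw [card_lowPairs_eq] at hfail
  have hne : (sparseSet (p := p) K w₂).Nonempty := by
    by_contra h0
    rw [not_nonempty_iff_eq_empty] at h0
    rw [h0, sum_empty] at hfail
    exact Nat.not_lt_zero _ hfail
  apply exists_lt_of_sum_lt
  rw [sum_const, smul_eq_mul, ← sum_mul, mul_comm]
  exact Nat.mul_lt_mul_of_pos_right hfail (card_pos.mpr hne)

/-- **K3a — THE SPECTRAL CONSEQUENCE OF NON-DISPERSION ((P7)(i)+(ii)+(iii)).**  If more than `E` ordered pairs of cube points have
`wt(A(x − x′)) < w₂` (the NEGATION of hypothesis (d2′) of `BilinearCubeSumA.norm_sq_bilinear_le_of_disperse` for the forms `c`), then for every `h`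
`E · p^K < #{v : wt v < w₂} · 4^{|ι|} · (|Ξ_h| + p^K (cos²(π/p))^{h+1})` — i.e. once `h` makes the tail small, the symmetric, `0`-containing,
subadditively-graded level set `Ξ_h` occupies a `≥ α` fraction of the dual space.  [Next, in print: Bogolyubov–Ruzsa (Sanders, arXiv:1011.0107
Thm 20) on `Ξ_h + Ξ_h ⊆ Ξ_{2h}` and the rank bound (P7)(v).] -/
theorem nonDisperse_levelSet (hp2 : 2 ≤ p) (w₂ E : ℕ)
    (hfail : E < (univ.filter fun xx : (ι → Bool) × (ι → Bool) =>
      (univ.filter fun j => diffMap c xx j ≠ 0).card < w₂).card) (h : ℕ) :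
    (E : ℝ) * (p : ℝ) ^ K
      < (sparseSet (p := p) K w₂).card *
          (4 ^ Fintype.card ι * ((levelSet c h).card + (p : ℝ) ^ K * (Real.cos (Real.pi / p) ^ 2) ^ (h + 1))) := by
  classical
  obtain ⟨v, _, hlt⟩ := exists_popular_sparse c w₂ E hfail
  have hp0 : (0 : ℝ) < p := by exact_mod_cast (lt_of_lt_of_le (by norm_num) hp2 : 0 < p)
  have h1 : (E : ℝ) * (p : ℝ) ^ K < (pairCount c v : ℝ) * (sparseSet (p := p) K w₂).card * (p : ℝ) ^ K := by
    have : (E : ℝ) < (pairCount c v : ℝ) * (sparseSet (p := p) K w₂).card := by exact_mod_cast hlt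
    exact mul_lt_mul_of_pos_right this (pow_pos hp0 K)
  have h3 := spectral_sum_le c (Real.cos (Real.pi / p) ^ 2) (sq_nonneg _) (Real.cos_sq_le_one _) h
  simp only [nDual] at h3
  have h2 : (pairCount c v : ℝ) * (p : ℝ) ^ K
      ≤ 4 ^ Fintype.card ι * ((levelSet c h).card + (p : ℝ) ^ K * (Real.cos (Real.pi / p) ^ 2) ^ (h + 1)) :=
    (card_pairs_le_cos hp2 c v).trans (mul_le_mul_of_nonneg_left h3 (by positivity))
  calc (E : ℝ) * (p : ℝ) ^ K < (pairCount c v : ℝ) * (sparseSet (p := p) K w₂).card * (p : ℝ) ^ K := h1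
    _ = (sparseSet (p := p) K w₂).card * ((pairCount c v : ℝ) * (p : ℝ) ^ K) := by ring
    _ ≤ _ := mul_le_mul_of_nonneg_left h2 (Nat.cast_nonneg _)

end LevelSet

end Summit.QuantumAdvantage.QuantumAdvantage.Theorems.PairLaw
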